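import Summits.KontsevichZagierPeriods.Zeta5Search.RVLargeParamVULayer
import HarnessLib

/-!
# RVLargeParamVZLayerLemmas — the ZERO-LAYER case of the constant-term floor (V⁺): test and lemmas (fam-rv gen 9, file 4)

HONEST FRAMING: systematic search; no irrationality claim unless certified.  This file mints NO conjecture.  With its sequel
`RVLargeParamVZLayer.lean` it PROVES, from tree theorems only, `v_p V(c) ≥ −4` for the canonical constant term `V(c)` of the
Brown–Zudilin cellular form under the decidable configuration test `zLayerCase c p t` — a common generalisation of the U-LAYER
case (`RVLargeParamVULayer.lean`) that also covers the three residual patterns left by gen 9's first three tests (a ZERO next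
to a sextic pole, level-zero mirror partners at `b₀ = 2p`, deficient poles at level two).  `p`-adic valuations of rational
numbers only; nothing about irrationality.

THE MECHANISM (top-layer accounting).  For a pole `s` put `μ_s := c_{5,s} + p·c_{4,s}` (`muTop`): read at the first multiple of
`p`, the two top layers of the principal part of `R_c` at `s` are `μ_s · p⁻⁶`, and the lower layers of an isolated pole have norm
`≤ p⁴` (Theorem A′).  (1) TOTAL: `Σ_{s ≤ b₀} μ_s = p · U(c)` — the `c_{5,·}` total vanishes by the reflection antisymmetry
`c_{5,b₀−s} = −c_{5,s}` (`CellA.pfData_reflect`) — and `p ∣ U(c)` by THEOREM C (`wrappedDivisibilityU_holds`, `4p ≤ 2d+3`, `H(5)`),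
so the total has norm `≤ p⁻²` (`sum_muTop_eq`).  (2) CONTROLLED POLES have `‖μ_s‖ ≤ p⁻²` individually: a ZERO PARTNER (`s ≥ p`
alone in its class with a zero of `R_c` at `s − p`) because the principal part of `R_c` at `s` evaluated at the zero is
`p`-integral (`padicNorm_polar_le_one`, the engine of `ZeroEvaluation`; `padicNorm_muTop_le_of_zero`), and a pole in a class of
exponent `≥ −4` by Theorem A (`clusterBound_holds`; `padicNorm_muTop_le_of_exp`); poles of order `≤ 4` have `μ_s = 0`.
(3) LEVEL-ZERO PARTNERS (`lzd`: a quintic pole `u < p` whose mirror image is a quintic deficient pole) satisfy `μ_u = μ_{b₀−u}`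
(even-order reflection, `muTop_mirror`), so they DOUBLE the deficient total instead of perturbing it.  Hence the deficient poles
have `‖Σ μ_q‖ ≤ p⁻²`, which is exactly what the level expansion of `V` needs (sequel).  Coverage: exact census
`pub-zeta5-fam-rv/gen9/rv9_zlayer.py` (`out/zlayer_*.json`): together with the counting and palindromic tests the zero-layer
test leaves NO residual pair for `b₀ ≤ 25` (594,471 pairs `(c,p)`; the bound was re-checked exactly on every firing pair).
-/

noncomputable section

open Finset

namespace Summit.KontsevichZagierPeriods.Zeta5Search.ClusterValuation

open Summit.KontsevichZagierPeriods.Zeta5Search.WedgeDictionary (coeffV dOf)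
open Summit.KontsevichZagierPeriods.Zeta5Search.CasoratianValuation (InPolytope)
open Summit.KontsevichZagierPeriods.Zeta5Search.PadicSeries

variable {p : ℕ} [hp : Fact p.Prime]

section ZLayer

open Summit.KontsevichZagierPeriods.Zeta5Search.WedgeDictionary (pfData coeffU)
open Literature.NumberTheory.Transcendental.BallRivoal (harm)

/-- `μ_s := c_{5,s} + p·c_{4,s}`: the top two layers of the pole `s` read at the first multiple of `p`
(`p⁶ · (c_{5,s} p⁻⁶ + c_{4,s} p⁻⁵)`). -/
noncomputable def muTop (c : ℕ → ℤ) (p s : ℕ) : ℚ := pfData c 5 s + (p : ℚ) * pfData c 4 s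

/-- LEVEL-ZERO PARTNER (Boolean test): `u < p` is a quintic pole whose mirror image `b₀ − u` is a quintic deficient pole. -/
def lzd (c : ℕ → ℤ) (p u : ℕ) : Bool :=
  decide (u < p) && decide (netExp c u = -5) && decide (netExp c ((c 0).toNat - u) = -5) && inQ c p ((c 0).toNat - u)

omit hp in
/-- Unfolding of the level-zero-partner test. -/
theorem lzd_iff (c : ℕ → ℤ) (p u : ℕ) : lzd c p u = true ↔
    u < p ∧ netExp c u = -5 ∧ netExp c ((c 0).toNat - u) = -5 ∧ inQ c p ((c 0).toNat - u) = true := by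
  simp only [lzd, Bool.and_eq_true, decide_eq_true_eq, and_assoc]

/-- ZERO-LAYER configuration test (decidable): target `t ≤ −4`; THEOREM C applies to `U` (`4p ≤ 2d+3`, `H(5)`); (D) every
deficient class has exactly one pole `q`, at level one or two (`p ≤ q < 3p`), with a ZERO at `q − 2p` when at level two; (C) every
pole `s` of order `≥ 5` outside the deficient classes is a ZERO PARTNER (`p ≤ s`, alone in its class, zero at `s − p`), or lies in
a class of exponent `≥ −4`, or is a level-zero partner (`lzd`); (M) either no level-zero partner occurs, or every deficient pole is
quintic with a level-zero partner as mirror image. -/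
def zLayerCase (c : ℕ → ℤ) (p : ℕ) (t : ℤ) : Bool :=
  decide (t ≤ -4) && decide (4 * (p : ℤ) ≤ 2 * dOf c + 3) && decide (GoodClasses c p 5) &&
    decide (∀ x ∈ range p, defClass c p x = true → classPoleCount c p x = 1 ∧
      ∀ s ∈ classSet c p x, netExp c s < 0 → p ≤ s ∧ s < 3 * p ∧ (2 * p ≤ s → 0 < netExp c (s - 2 * p))) &&
    decide (∀ x ∈ range p, ∀ s ∈ classSet c p x, netExp c s ≤ -5 → defClass c p x = false →
      (p ≤ s ∧ classPoleCount c p x = 1 ∧ 0 < netExp c (s - p)) ∨ -4 ≤ classExp c p x ∨ lzd c p s = true) &&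
    (decide (∀ x ∈ range p, ∀ s ∈ classSet c p x, lzd c p s = false) ||
      decide (∀ x ∈ range p, ∀ s ∈ classSet c p x, inQ c p s = true → netExp c s = -5 ∧ lzd c p ((c 0).toNat - s) = true))

/-- Unpacking of (D) at a deficient pole. -/
theorem qSet_specZ (c : ℕ → ℤ)
    (hD : ∀ x ∈ range p, defClass c p x = true → classPoleCount c p x = 1 ∧
      ∀ s ∈ classSet c p x, netExp c s < 0 → p ≤ s ∧ s < 3 * p ∧ (2 * p ≤ s → 0 < netExp c (s - 2 * p)))
    {s : ℕ} (hs : s ∈ qSet c p) :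
    s ≤ (c 0).toNat ∧ netExp c s < 0 ∧ classPoleCount c p s = 1 ∧ p ≤ s ∧ s < 3 * p ∧
      (2 * p ≤ s → 0 < netExp c (s - 2 * p)) := by
  obtain ⟨hsR, hq⟩ := mem_filter.1 hs
  obtain ⟨hneg, hdef⟩ := (inQ_iff c p s).1 hq
  have hs' : s ≤ (c 0).toNat := by have := mem_range.1 hsR; omega
  obtain ⟨hcnt, hall⟩ := hD (s % p) (mem_range.2 (Nat.mod_lt _ hp.out.pos)) hdef
  obtain ⟨hps, hs3, hz⟩ := hall s (mem_classSet_mod c hs') hneg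
  exact ⟨hs', hneg, by rw [classPoleCount_mod]; exact hcnt, hps, hs3, hz⟩

omit hp in
/-- A pole alone in its class: every other point of the class is regular (multiplicity `≥ 6`). -/
theorem mult_ge_six_of_single (c : ℕ → ℤ) {s : ℕ} (hs : s ≤ (c 0).toNat) (hneg : netExp c s < 0)
    (hcnt : classPoleCount c p s = 1) :
    ∀ s', s' ≤ (c 0).toNat → s' ≠ s → (p : ℤ) ∣ (s' : ℤ) - s → 6 ≤ mult c s' := by
  intro s' hs'n hne hdvd
  have hcnt' : classPoleCount c p (s % p) = 1 := by rw [← classPoleCount_mod]; exact hcnt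
  have hmod : (p : ℤ) ∣ (s : ℤ) - ((s % p : ℕ) : ℤ) := by
    have h0 : p ∣ s - s % p := Nat.dvd_sub_mod s
    have h := Int.natCast_dvd_natCast.2 h0
    rwa [Nat.cast_sub (Nat.mod_le s p)] at h
  have hs'x : s' ∈ classSet c p (s % p) := (mem_classSet_iff c (s % p) s').2 ⟨hs'n, by
    have e : (s' : ℤ) - ((s % p : ℕ) : ℤ) = ((s' : ℤ) - s) + ((s : ℤ) - ((s % p : ℕ) : ℤ)) := by ring
    rw [e]; exact hdvd.add hmod⟩
  have h0 := netExp_nonneg_of_unique_pole c hcnt' (mem_classSet_mod c hs) hneg hs'x hne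
  have := mult_eq_netExp c s'
  omega

omit hp in
/-- Poles of order `≤ 4` carry no top layers. -/
theorem muTop_eq_zero_of_order_le (c : ℕ → ℤ) (hc : InPolytope c) {s : ℕ} (hs : s ≤ (c 0).toNat)
    (hord : -4 ≤ netExp c s) : muTop c p s = 0 := by
  unfold muTop
  rw [CellA.pfData_eq_zero_of_order_le c hc hs (show 5 < 6 by norm_num) (by push_cast; omega),
    CellA.pfData_eq_zero_of_order_le c hc hs (show 4 < 6 by norm_num) (by push_cast; omega)]
  ring

omit hp in
/-- A level-zero partner and its mirror image carry the same top layers (even-order reflection `c_{4,b₀−u} = c_{4,u}`). -/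
theorem muTop_mirror (c : ℕ → ℤ) (hc : InPolytope c) {u : ℕ} (hu : u ≤ (c 0).toNat) (h5 : netExp c u = -5)
    (h5' : netExp c ((c 0).toNat - u) = -5) : muTop c p u = muTop c p ((c 0).toNat - u) := by
  unfold muTop
  rw [CellA.pfData_eq_zero_of_order_le c hc hu (show 5 < 6 by norm_num) (by push_cast; omega),
    CellA.pfData_eq_zero_of_order_le c hc (s := (c 0).toNat - u) (by omega) (show 5 < 6 by norm_num) (by push_cast; omega),
    CellA.pfData_reflect c hc hu (show 4 < 6 by norm_num)]
  norm_num

/-- The lower layers of an isolated pole: `‖Σ_{o<6} c_{o,s} p^{−(o+1)} − μ_s p⁻⁶‖ ≤ p⁴`. -/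
theorem padicNorm_posVsing_sub_le (c : ℕ → ℤ) (hc : InPolytope c) (hp5 : 5 ≤ p) (hwin : (c 0 + 2 : ℤ) < (p : ℤ) ^ 2)
    {s : ℕ} (hs : s ≤ (c 0).toNat) (hcnt : classPoleCount c p s = 1) :
    padicNorm p (posVsing c p s - muTop c p s / (p : ℚ) ^ 6) ≤ (p : ℚ) ^ 4 := by
  have hp0 : (p : ℚ) ≠ 0 := Nat.cast_ne_zero.2 hp.out.ne_zero
  have heq : posVsing c p s - muTop c p s / (p : ℚ) ^ 6 = ∑ o ∈ range 4, pfData c o s / (p : ℚ) ^ (o + 1) := by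
    unfold posVsing muTop
    simp only [Finset.sum_range_succ, Finset.sum_range_zero]
    field_simp
    ring
  rw [heq]
  refine padicNorm.sum_le' (fun o ho => ?_) (by positivity)
  have ho4 := mem_range.1 ho
  rw [padicNorm.div, CellA.padicNorm_p_pow, div_inv_eq_mul]
  calc padicNorm p (pfData c o s) * (p : ℚ) ^ (o + 1) ≤ 1 * (p : ℚ) ^ 4 :=
        mul_le_mul (padicNorm_pfData_le_one c hc hp5 hwin hs hcnt (by omega)) (pow_le_pow_right₀ one_le_p (by omega))
          (by positivity) zero_le_one
    _ = (p : ℚ) ^ 4 := one_mul _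

/-- **ZERO PARTNER:** a pole `s ≥ p`, alone in its class, with a ZERO at `s − p` has `‖μ_s‖ ≤ p⁻²` — the polar part of `R_c` at the
zero is `p`-integral (`padicNorm_polar_le_one`, the engine of `ZeroEvaluation`), and its lower layers have norm `≤ p⁴`. -/
theorem padicNorm_muTop_le_of_zero (c : ℕ → ℤ) (hc : InPolytope c) (hp5 : 5 ≤ p) (hwin : (c 0 + 2 : ℤ) < (p : ℤ) ^ 2)
    {s : ℕ} (hs : s ≤ (c 0).toNat) (hneg : netExp c s < 0) (hcnt : classPoleCount c p s = 1) (hps : p ≤ s)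
    (hz : 0 < netExp c (s - p)) : padicNorm p (muTop c p s) ≤ (p : ℚ) ^ (-2 : ℤ) := by
  obtain ⟨-, -, -, hn⟩ := thmA_data c hc hwin
  have hp2 : p ≠ 2 := by have := hp5; omega
  have hp0 : (p : ℚ) ≠ 0 := Nat.cast_ne_zero.2 hp.out.ne_zero
  have hpol : padicNorm p (posVsing c p s) ≤ 1 := by
    have h := padicNorm_polar_le_one c hc hs hn hp2 hp.out.one_lt.le hps (dvd_refl _)
      (by have := mult_eq_netExp c (s - p); omega) (mult_ge_six_of_single c hs hneg hcnt)
    unfold posVsing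
    exact h
  have hlow := padicNorm_posVsing_sub_le c hc hp5 hwin hs hcnt
  have hkey : padicNorm p (muTop c p s / (p : ℚ) ^ 6) ≤ (p : ℚ) ^ 4 := by
    have e : muTop c p s / (p : ℚ) ^ 6 = posVsing c p s - (posVsing c p s - muTop c p s / (p : ℚ) ^ 6) := by ring
    rw [e]
    exact (padicNorm.sub (p := p)).trans (max_le (hpol.trans (one_le_pow₀ one_le_p)) hlow)
  rw [padicNorm.div, CellA.padicNorm_p_pow, div_inv_eq_mul] at hkey
  have h6 : (0 : ℚ) < (p : ℚ) ^ 6 := by positivity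
  calc padicNorm p (muTop c p s) ≤ (p : ℚ) ^ 4 / (p : ℚ) ^ 6 := (le_div_iff₀ h6).2 hkey
    _ = (p : ℚ) ^ (-2 : ℤ) := by
        rw [← zpow_natCast (p : ℚ) 4, ← zpow_natCast (p : ℚ) 6, ← zpow_sub₀ hp0]; norm_num

/-- A pole in a class of exponent `≥ −4` has `‖μ_s‖ ≤ p⁻²` (Theorem A, `clusterBound_holds`). -/
theorem padicNorm_muTop_le_of_exp (c : ℕ → ℤ) (hc : InPolytope c) (hp5 : 5 ≤ p) (hwin : (c 0 + 2 : ℤ) < (p : ℤ) ^ 2)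
    {s : ℕ} (hs : s ≤ (c 0).toNat) (hE : -4 ≤ classExp c p s) :
    padicNorm p (muTop c p s) ≤ (p : ℚ) ^ (-2 : ℤ) := by
  have hp0 : (p : ℚ) ≠ 0 := Nat.cast_ne_zero.2 hp.out.ne_zero
  have h5 : padicNorm p (pfData c 5 s) ≤ (p : ℚ) ^ (-2 : ℤ) := padicNorm_le_of_val fun hne => by
    have h := clusterBound_holds c p s 5 hc hp.out (by omega) hwin hs (by norm_num) hne
    push_cast at h; linarith
  have h4 : padicNorm p (pfData c 4 s) ≤ (p : ℚ) ^ (-1 : ℤ) := padicNorm_le_of_val fun hne => by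
    have h := clusterBound_holds c p s 4 hc hp.out (by omega) hwin hs (by norm_num) hne
    push_cast at h; linarith
  unfold muTop
  refine (padicNorm.nonarchimedean (p := p)).trans (max_le h5 ?_)
  rw [padicNorm.mul, padicNorm.padicNorm_p_of_prime]
  calc ((p : ℚ))⁻¹ * padicNorm p (pfData c 4 s) ≤ ((p : ℚ))⁻¹ * (p : ℚ) ^ (-1 : ℤ) :=
        mul_le_mul_of_nonneg_left h4 (by positivity)
    _ = (p : ℚ) ^ (-2 : ℤ) := by rw [← zpow_neg_one, ← zpow_add₀ hp0]; norm_num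

omit hp in
/-- **Total of the top layers:** `Σ_{s ≤ b₀} μ_s = p · U(c)` (the `c_{5,·}` sum vanishes by the reflection antisymmetry). -/
theorem sum_muTop_eq (c : ℕ → ℤ) (hc : InPolytope c) :
    ∑ s ∈ range ((c 0).toNat + 1), muTop c p s = (p : ℚ) * coeffU c := by
  have h := Finset.sum_range_reflect (fun s => pfData c 5 s) ((c 0).toNat + 1)
  have h' : ∑ j ∈ range ((c 0).toNat + 1), pfData c 5 ((c 0).toNat + 1 - 1 - j)
      = ∑ j ∈ range ((c 0).toNat + 1), -pfData c 5 j := by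
    refine Finset.sum_congr rfl fun j hj => ?_
    have hj' : j ≤ (c 0).toNat := by have := mem_range.1 hj; omega
    rw [show (c 0).toNat + 1 - 1 - j = (c 0).toNat - j by omega, CellA.pfData_reflect c hc hj' (by norm_num)]
    ring
  have h5 : ∑ s ∈ range ((c 0).toNat + 1), pfData c 5 s = 0 := by
    rw [h', Finset.sum_neg_distrib] at h
    linarith
  unfold muTop coeffU
  rw [Finset.sum_add_distrib, h5, zero_add, ← Finset.mul_sum]

end ZLayer

end Summit.KontsevichZagierPeriods.Zeta5Search.ClusterValuation
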